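import Literature.AnabelianGeometry.SemiGraphs.CoveringGraphPullbackSquare
import HarnessLib

/-!
# [SemiAnbd] §2 p.23 / Prop 4.4 (i) / Prop 4.6: the fibre square of a covering along a morphism, II — FIBREWISE
# CARTESIANITY and the naturality of point lifts along the second projection (proof-only)

Mochizuki, *Semi-graphs of anabelioids*, Publ. RIMS **42** (2006), §2 p. 23 («if `v` (respectively, `e`) is a vertex
(respectively, edge) of `𝔾`, then the vertices `v′` (respectively, edges `e′`) of `𝔾′` are the elements of the set of connected
components of the [not necessarily connected!] anabelioid `B′ ×_B 𝒢_v` (respectively, `B′ ×_B 𝒢_e`)»; the tree's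
«pull-backs», «lie over», `S_v` are its own vocabulary for these objects), Def. 3.5 (i) p. 37, Prop. 3.6 (iv) p. 39,
Prop. 4.4 (i) p. 54 («any connected component `H′` of the pull-back»), proof of Prop. 4.6 pp. 56–57
(kurims `paper:url-f33ace170ff4`). [cite: MochizukiSemiAnbd2006, Prop 3.6(iv) p.39]

abc-iut cell, layer L3, seat abc-iut-f-161 gen 8, row «PROP46⟸PULLBACK+P44i» stage 1a FILE B, over FILE A
`CoveringGraphPullbackSquare` (`Hom.covPullbackSnd` = the second projection `𝒢'_{ψ^*S} → 𝒢_S`).  PROOF-ONLY (no definition,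
no instance, no named fact).  With `S′ := (ψ.covPullbackWith θ).obj S`:
* §1 FIBRES.  Over a vertex `w` of `G′` the second projection maps the fibre of `𝒢'_{S′}` (the `Π_{G′,w}`-orbits of
  `S′_w = S_{ψ w}`) to the fibre of `𝒢_S` over `ψ w` (the `Π_{G,ψ w}`-orbits), `o ↦ Π_{G,ψ w}·pt o`:
  `covPullbackSnd_vertexMap_fst` (fibres go to fibres), **`covPullbackSnd_fibreV_surjective`** (EVERY vertex of `𝒢_S` over
  `ψ w` is hit — for any `ψ`), **`covPullbackSnd_fibreV_injective_of_surjective`** (injective on the fibre as soon as `ψ_w` is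
  surjective: then the two orbit partitions coincide); edges likewise.  So where `ψ` is locally trivial the square is
  CARTESIAN ON THE NOSE: `covPullbackSnd_hV_bijective_of_bijective` / `_hE_…` (bijective constituents) and
  `covPullbackSnd_isLocallyTrivial` — the case of the restriction of coverings to a sub-semi-graph (`ψ` an embedding), i.e.
  exactly the «pull-back of this finite étale covering to `H`» of Prop. 4.4 (i) after the reduction to a locally trivial
  `H → K` in its printed proof (p. 55, via Prop. 2.5 (i)).
* §2 NATURALITY OF POINT LIFTS.  A point system `(y′, z′)` of `S′` over `f : 𝔾_X → 𝔾_{G′}` IS a point system of `S` over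
  `f ≫ ψ`; its gluing condition for `S′` implies the one for `S` (`glueCondition_comp_of_covPullbackWith`), and abc-iut-L3-t3's
  point lift to `𝒢'_{S′}` followed by the second projection agrees ON VERTICES AND EDGES with the point lift to `𝒢_S`
  (`pointLift_covPullbackSnd_vertexMap` / `_edgeMap`) — the universal map of the square on underlying semi-graphs is
  computed by point lifts.
Finiteness of `S′` for finite `S` is abc-iut-L3-d4's `isFinite_covPullbackWith` (by name, not restated).  Nothing printed is
asserted; no side taken on [IUTchIII] Cor. 3.12.
-/

noncomputable section

namespace Literature.AnabelianGeometry.SemiGraphs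

open CategoryTheory
open Literature.AlgebraicGeometry.Frobenioids.QuasiTemperoid.BTempConnected (hom_ρ ρ_one_apply
  ρ_mul_apply ρ_inv_apply)

universe u

namespace ProfiniteSemiGraph

namespace Hom

variable {H₁ K : ProfiniteSemiGraph.{u}} (ψ : Hom H₁ K) (θ : ψ.ConjugatorFamily) (S : CovObj K)

/-! ## §1. Fibres of the second projection -/

/-- The second projection maps the fibre over `w` into the fibre over `ψ w`. [cite: MochizukiSemiAnbd2006, §2 p.23] -/
theorem covPullbackSnd_vertexMap_fst (ν : ((ψ.covPullbackWith θ).obj S).coveringSemiGraph.Vertex) :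
    ((ψ.covPullbackSnd θ S).base.vertexMap ν).1 = ψ.base.vertexMap ν.1 := rfl

/-- … and on edges. [cite: MochizukiSemiAnbd2006, §2 p.23] -/
theorem covPullbackSnd_edgeMap_fst (ε : ((ψ.covPullbackWith θ).obj S).coveringSemiGraph.Edge) :
    ((ψ.covPullbackSnd θ S).base.edgeMap ε).1 = ψ.base.edgeMap ε.1 := rfl

/-- **Every vertex of `𝒢_S` over `ψ w` is the image of a vertex of `𝒢'_{ψ^*S}` over `w`** (any `ψ`): the `Π_{G,ψ w}`-orbit
of a point `t` is the image of the `Π_{G′,w}`-orbit of `t`. [cite: MochizukiSemiAnbd2006, §2 p.23] -/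
theorem covPullbackSnd_fibreV_surjective (w : H₁.graph.Vertex) (O : BTemp.Orbits (S.SV (ψ.base.vertexMap w))) :
    ∃ o : BTemp.Orbits (((ψ.covPullbackWith θ).obj S).SV w),
      (ψ.covPullbackSnd θ S).base.vertexMap ⟨w, o⟩ = ⟨ψ.base.vertexMap w, O⟩ := by
  induction O using Quot.ind with
  | mk t =>
    refine ⟨BTemp.cl (((ψ.covPullbackWith θ).obj S).SV w) t, ?_⟩
    rw [covPullbackSnd_base_vertexMap]
    congr 1
    -- `pt (cl′ t)` is `Π_{G′,w}`-related, hence `Π_{G,ψ w}`-related, to `t`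
    obtain ⟨m, hm⟩ := (BTemp.cl_eq_cl_iff (((ψ.covPullbackWith θ).obj S).SV w) _ _).mp
      (Quot.out_eq (BTemp.cl (((ψ.covPullbackWith θ).obj S).SV w) t)).symm
    exact ((BTemp.cl_eq_cl_iff _ _ _).mpr ⟨ψ.hV w m, hm⟩).symm

/-- The edge analogue. [cite: MochizukiSemiAnbd2006, §2 p.23] -/
theorem covPullbackSnd_fibreE_surjective (e' : H₁.graph.Edge) (O : BTemp.Orbits (S.SE (ψ.base.edgeMap e'))) :
    ∃ o : BTemp.Orbits (((ψ.covPullbackWith θ).obj S).SE e'),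
      (ψ.covPullbackSnd θ S).base.edgeMap ⟨e', o⟩ = ⟨ψ.base.edgeMap e', O⟩ := by
  induction O using Quot.ind with
  | mk t =>
    refine ⟨BTemp.cl (((ψ.covPullbackWith θ).obj S).SE e') t, ?_⟩
    rw [covPullbackSnd_base_edgeMap]
    congr 1
    obtain ⟨m, hm⟩ := (BTemp.cl_eq_cl_iff (((ψ.covPullbackWith θ).obj S).SE e') _ _).mp
      (Quot.out_eq (BTemp.cl (((ψ.covPullbackWith θ).obj S).SE e') t)).symm
    exact ((BTemp.cl_eq_cl_iff _ _ _).mpr ⟨ψ.hE e' m, hm⟩).symm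

/-- **Injective on the fibre over `w` as soon as `ψ_w` is surjective**: then the `Π_{G′,w}`-orbits of `S′_w = S_{ψ w}` ARE the
`Π_{G,ψ w}`-orbits. [cite: MochizukiSemiAnbd2006, §2 p.23] -/
theorem covPullbackSnd_fibreV_injective_of_surjective (w : H₁.graph.Vertex) (hψ : Function.Surjective (ψ.hV w))
    (o₁ o₂ : BTemp.Orbits (((ψ.covPullbackWith θ).obj S).SV w))
    (h : (ψ.covPullbackSnd θ S).base.vertexMap ⟨w, o₁⟩ = (ψ.covPullbackSnd θ S).base.vertexMap ⟨w, o₂⟩) : o₁ = o₂ := by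
  rw [covPullbackSnd_base_vertexMap, covPullbackSnd_base_vertexMap] at h
  have h2 : BTemp.cl (S.SV (ψ.base.vertexMap w)) (Quot.out o₁) = BTemp.cl (S.SV (ψ.base.vertexMap w)) (Quot.out o₂) :=
    eq_of_heq (Sigma.mk.inj_iff.mp h).2
  obtain ⟨k, hk⟩ := (BTemp.cl_eq_cl_iff _ _ _).mp h2
  obtain ⟨m, rfl⟩ := hψ k
  rw [← Quot.out_eq o₁, ← Quot.out_eq o₂]
  exact (BTemp.cl_eq_cl_iff (((ψ.covPullbackWith θ).obj S).SV w) _ _).mpr ⟨m, hk⟩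

/-- The edge analogue. [cite: MochizukiSemiAnbd2006, §2 p.23] -/
theorem covPullbackSnd_fibreE_injective_of_surjective (e' : H₁.graph.Edge) (hψ : Function.Surjective (ψ.hE e'))
    (o₁ o₂ : BTemp.Orbits (((ψ.covPullbackWith θ).obj S).SE e'))
    (h : (ψ.covPullbackSnd θ S).base.edgeMap ⟨e', o₁⟩ = (ψ.covPullbackSnd θ S).base.edgeMap ⟨e', o₂⟩) : o₁ = o₂ := by
  rw [covPullbackSnd_base_edgeMap, covPullbackSnd_base_edgeMap] at h
  have h2 : BTemp.cl (S.SE (ψ.base.edgeMap e')) (Quot.out o₁) = BTemp.cl (S.SE (ψ.base.edgeMap e')) (Quot.out o₂) :=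
    eq_of_heq (Sigma.mk.inj_iff.mp h).2
  obtain ⟨k, hk⟩ := (BTemp.cl_eq_cl_iff _ _ _).mp h2
  obtain ⟨m, rfl⟩ := hψ k
  rw [← Quot.out_eq o₁, ← Quot.out_eq o₂]
  exact (BTemp.cl_eq_cl_iff (((ψ.covPullbackWith θ).obj S).SE e') _ _).mpr ⟨m, hk⟩

/-- **Bijective vertex constituents where `ψ_w` is bijective**: the second projection's constituent at `(w, o)`,
`Stab_{Π_{G′,w}}(pt o) → Stab_{Π_{G,ψ w}}(x_{[pt o]})`, is injective as `ψ_w` is and onto because a stabiliser element of `Π_{G,ψ w}`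
lifts along the surjection `ψ_w` to an element that stabilises for the action THROUGH `ψ_w`. [cite: MochizukiSemiAnbd2006, Rem. 2.2.1 p.24] -/
theorem covPullbackSnd_hV_bijective_of_bijective (ν : ((ψ.covPullbackWith θ).obj S).coveringSemiGraph.Vertex)
    (hψ : Function.Bijective (ψ.hV ν.1)) : Function.Bijective ((ψ.covPullbackSnd θ S).hV ν) := by
  refine ⟨ψ.covPullbackSnd_hV_injective θ S ν hψ.1, ?_⟩
  rw [covPullbackSnd_hV]
  refine conjInto_surjective _ _ _ _ fun k hk => ?_
  -- `g⁻¹ k g` stabilises `pt o`; lift it along `ψ_w`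
  have hk' := CovObj.conj_inv_mem_stab _ _ _
    (CovObj.gV_spec (((ψ.covPullbackWith θ).obj S).coveringHom.comp ψ) S (ψ.covPullbackPtV θ S) ν) hk
  obtain ⟨m, hm⟩ := hψ.2 ((CovObj.gV (((ψ.covPullbackWith θ).obj S).coveringHom.comp ψ) S
    (ψ.covPullbackPtV θ S) ν)⁻¹ * k * CovObj.gV (((ψ.covPullbackWith θ).obj S).coveringHom.comp ψ) S
    (ψ.covPullbackPtV θ S) ν)
  have hmstab : m ∈ BTemp.stab (((ψ.covPullbackWith θ).obj S).SV ν.1) (Quot.out ν.2) := by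
    change (S.SV (ψ.base.vertexMap ν.1)).obj.ρ (ψ.hV ν.1 m) (Quot.out ν.2) = Quot.out ν.2
    rw [hm]
    exact hk'
  exact ⟨⟨m, hmstab⟩, hm⟩

/-- The edge analogue. [cite: MochizukiSemiAnbd2006, Rem. 2.2.1 p.24] -/
theorem covPullbackSnd_hE_bijective_of_bijective (ε : ((ψ.covPullbackWith θ).obj S).coveringSemiGraph.Edge)
    (hψ : Function.Bijective (ψ.hE ε.1)) : Function.Bijective ((ψ.covPullbackSnd θ S).hE ε) := by
  refine ⟨ψ.covPullbackSnd_hE_injective θ S ε hψ.1, ?_⟩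
  rw [covPullbackSnd_hE]
  refine conjInto_surjective _ _ _ _ fun k hk => ?_
  have hk' := CovObj.conj_inv_mem_stab _ _ _
    (CovObj.gE_spec (((ψ.covPullbackWith θ).obj S).coveringHom.comp ψ) S (ψ.covPullbackPtE θ S) ε) hk
  obtain ⟨m, hm⟩ := hψ.2 ((CovObj.gE (((ψ.covPullbackWith θ).obj S).coveringHom.comp ψ) S
    (ψ.covPullbackPtE θ S) ε)⁻¹ * k * CovObj.gE (((ψ.covPullbackWith θ).obj S).coveringHom.comp ψ) S
    (ψ.covPullbackPtE θ S) ε)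
  have hmstab : m ∈ BTemp.stab (((ψ.covPullbackWith θ).obj S).SE ε.1) (Quot.out ε.2) := by
    change (S.SE (ψ.base.edgeMap ε.1)).obj.ρ (ψ.hE ε.1 m) (Quot.out ε.2) = Quot.out ε.2
    rw [hm]
    exact hk'
  exact ⟨⟨m, hmstab⟩, hm⟩

/-- **Over a locally trivial `ψ` the second projection is locally trivial** (bijective constituents everywhere) — with
§1's fibrewise bijections, the square is then cartesian on the nose; this is the case `ψ` = the embedding of a
sub-semi-graph, i.e. the restriction of coverings used by Prop. 4.4 (i) after its reduction to a locally trivial arrow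
(p. 55). [cite: MochizukiSemiAnbd2006, Prop 4.4(i) p.54] -/
theorem covPullbackSnd_isLocallyTrivial (hψ : ψ.IsLocallyTrivial) : (ψ.covPullbackSnd θ S).IsLocallyTrivial :=
  ⟨fun ν => ψ.covPullbackSnd_hV_bijective_of_bijective θ S ν (hψ.1 ν.1),
    fun ε => ψ.covPullbackSnd_hE_bijective_of_bijective θ S ε (hψ.2 ε.1)⟩

/-! ## §2. Naturality of point lifts along the second projection -/

variable {X : SemiGraph.{u}} (f : X ⟶ H₁.graph)
  (y' : ∀ w : X.Vertex, (((ψ.covPullbackWith θ).obj S).SV (f.vertexMap w)).obj.V)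
  (z' : ∀ e' : X.Edge, (((ψ.covPullbackWith θ).obj S).SE (f.edgeMap e')).obj.V)

/-- **A point system of `ψ^*S` over `f` IS a point system of `S` over `f ≫ ψ`, and its gluing condition for `ψ^*S` implies the
one for `S`**: the gluing of `ψ^*S` is that of `S` followed by `θ_{b′}`, and a `Π_{G′,w}`-orbit lies in a `Π_{G,ψ w}`-orbit.
[cite: MochizukiSemiAnbd2006, Prop 3.6(iv) p.39] -/
theorem glueCondition_comp_of_covPullbackWith (h' : ((ψ.covPullbackWith θ).obj S).GlueCondition f y' z') :
    S.GlueCondition (f ≫ ψ.base) y' z' := by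
  refine ⟨fun b' w hb => ?_⟩
  obtain ⟨m, hm⟩ := (BTemp.cl_eq_cl_iff _ _ _).mp (h'.cl_glue_eq b' w hb)
  rw [covPullbackWith_glue_apply, S.eqRec_eq_castPtE (ψ.base.edgeOf_branchMap (f.branchMap b'))] at hm
  change (S.SV (ψ.base.vertexMap (f.vertexMap w))).obj.ρ (ψ.hV (f.vertexMap w) m) _ = _ at hm
  rw [← ρ_mul_apply] at hm
  -- compare the two transports of `z′_{e′}` into the fibre over `edgeOf (ψ (f b′))`
  have hcast : ∀ {e₀ : H₁.graph.Edge} (h₀ : e₀ = f.edgeMap (X.edgeOf b')) {e₁ : K.graph.Edge}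
      (h₁ : ψ.base.edgeMap e₀ = e₁) (h₂ : ψ.base.edgeMap (f.edgeMap (X.edgeOf b')) = e₁),
      S.castPtE h₁ ((((ψ.covPullbackWith θ).obj S).castPtE h₀.symm (z' (X.edgeOf b')))) = S.castPtE h₂ (z' (X.edgeOf b')) := by
    intro e₀ h₀ e₁ h₁ h₂
    subst h₀
    subst h₁
    rfl
  show BTemp.cl (S.SV (ψ.base.vertexMap (f.vertexMap w))) ((S.glue (ψ.base.branchMap (f.branchMap b'))
      (ψ.base.vertexMap (f.vertexMap w)) _).hom.hom.hom (S.castPtE _ (z' (X.edgeOf b')))) =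
    BTemp.cl (S.SV (ψ.base.vertexMap (f.vertexMap w))) (y' w)
  rw [← hcast (f.edgeOf_branchMap b') (ψ.base.edgeOf_branchMap (f.branchMap b')).symm, BTemp.cl_eq_cl_iff]
  exact ⟨_, hm⟩

/-- **Naturality on vertices**: the point lift of `(y′, z′)` to `𝒢'_{ψ^*S}` followed by the second projection sends `w` to the
value at `w` of the point lift of the same points to `𝒢_S` — `(ψ (f w), Π_{G,ψ f w}·y′_w)`. [cite: MochizukiSemiAnbd2006, Def 3.5(i) p.37] -/
theorem pointLift_covPullbackSnd_vertexMap (h' : ((ψ.covPullbackWith θ).obj S).GlueCondition f y' z') (w : X.Vertex) :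
    (ψ.covPullbackSnd θ S).base.vertexMap ((((ψ.covPullbackWith θ).obj S).pointLift f y' z' h').vertexMap w) =
      (S.pointLift (f ≫ ψ.base) y' z' (ψ.glueCondition_comp_of_covPullbackWith θ S f y' z' h')).vertexMap w := by
  rw [CovObj.pointLift_vertexMap, covPullbackSnd_base_vertexMap, CovObj.pointLift_vertexMap]
  show (⟨ψ.base.vertexMap (f.vertexMap w), _⟩ : S.coveringSemiGraph.Vertex) = ⟨ψ.base.vertexMap (f.vertexMap w), _⟩
  congr 1
  obtain ⟨m, hm⟩ := (BTemp.cl_eq_cl_iff (((ψ.covPullbackWith θ).obj S).SV (f.vertexMap w)) _ _).mp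
    (Quot.out_eq (BTemp.cl (((ψ.covPullbackWith θ).obj S).SV (f.vertexMap w)) (y' w))).symm
  exact ((BTemp.cl_eq_cl_iff _ _ _).mpr ⟨ψ.hV (f.vertexMap w) m, hm⟩).symm

/-- **Naturality on edges.** [cite: MochizukiSemiAnbd2006, Def 3.5(i) p.37] -/
theorem pointLift_covPullbackSnd_edgeMap (h' : ((ψ.covPullbackWith θ).obj S).GlueCondition f y' z') (e' : X.Edge) :
    (ψ.covPullbackSnd θ S).base.edgeMap ((((ψ.covPullbackWith θ).obj S).pointLift f y' z' h').edgeMap e') =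
      (S.pointLift (f ≫ ψ.base) y' z' (ψ.glueCondition_comp_of_covPullbackWith θ S f y' z' h')).edgeMap e' := by
  rw [CovObj.pointLift_edgeMap, covPullbackSnd_base_edgeMap, CovObj.pointLift_edgeMap]
  show (⟨ψ.base.edgeMap (f.edgeMap e'), _⟩ : S.coveringSemiGraph.Edge) = ⟨ψ.base.edgeMap (f.edgeMap e'), _⟩
  congr 1
  obtain ⟨m, hm⟩ := (BTemp.cl_eq_cl_iff (((ψ.covPullbackWith θ).obj S).SE (f.edgeMap e')) _ _).mp
    (Quot.out_eq (BTemp.cl (((ψ.covPullbackWith θ).obj S).SE (f.edgeMap e')) (z' e'))).symm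
  exact ((BTemp.cl_eq_cl_iff _ _ _).mpr ⟨ψ.hE (f.edgeMap e') m, hm⟩).symm

end Hom

end ProfiniteSemiGraph

end Literature.AnabelianGeometry.SemiGraphs

end
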